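import Mathlib
import HarnessLib
import Summits.Ventures.LatticeQCDFlow.Scoring.BatchMeansConsistencyEnvelope
import Summits.Ventures.LatticeQCDFlow.Scoring.DoeblinPowerGeometricEnvelope

/-!
# THE BATCH-MEANS ESTIMATOR OF THE ASYMPTOTIC VARIANCE IS CONSISTENT FOR EVERY KERNEL WITH A
# DOEBLIN POWER `(nHit κ m)(x, ·) ≥ ε ν`, from any initial law: `E_{μ₀}[(σ̂²_{a,b} − σ²_f)²] ≤ K/a + K'/b`

HONEST FRAMING: exact (Metropolis-corrected) sampling algorithms for lattice gauge theory;
figures of merit are autocorrelation/cost numbers at stated couplings and volumes; no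
continuum-physics claim.

Venture `LatticeQCDFlow` (cell pub-lqcd), topic `Scoring`; FANOUT row 8 (`s0-cpn-nemc`, GEN-20).
NEW WORK of the cell, not a published result; no definition is introduced; nothing is cited as a
fact.  GEN-19 proved the mean-square consistency of the non-overlapping batch-means estimator
`σ̂²_{a,b} = ab · SE²_BM` of the Green–Kubo variance `σ²_f` for kernels minorised in ONE step
(`Scoring/BatchMeansConsistency.lean`).  The cell's composite samplers — a Metropolis or heat-bath
SWEEP followed by exact updates, an HMC trajectory, the engine's NCMC lane (two-step Doeblin,
row 13's `NCMCGeneralSpaceOccupancyChainDoeblin`) — certify only a POWER: `(nHit κ m)(x, ·) ≥ ε ν`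
(`0 < ε ≤ 1`, `0 < m`), i.e. uniform ergodicity.  This file states the consistency for that
certificate shape: the `m`-step minorisation gives a geometric sup-norm envelope
(`Scoring/DoeblinPowerGeometricEnvelope.exists_geometricEnvelope_of_nHit`: `ρ = 1 − e/(m+1)`,
`A = (ρ^m)⁻¹`), and the envelope gives the mean-square bound and the convergence in probability
(`Scoring/BatchMeansConsistencyEnvelope.lean`, GEN-19's Poisson–martingale / block-decorrelation
route re-run on the envelope).  The one-step theorem is the case `m = 1` (`nHit κ 1 = κ`).  Printed
counterparts NAMED ONLY: consistency of batch means for uniformly / geometrically ergodic chains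
(Glynn–Whitt 1991; Damerdji 1994; Jones–Haran–Caffo–Neath 2006; Flegal–Jones 2010).

## Content (`π` invariant, `(nHit κ m)(x, ·) ≥ ε ν` with `ν` a probability law, `0 < ε ≤ 1`,
## `0 < m`; `|f| ≤ C` measurable; `σ²_f = ∫ f̄² dπ + 2 Σ_{k≥1} ∫ f̄ (kop κ)^[k] f̄ dπ`; `P_{μ₀}` the
## chain's path law from ANY initial law; `SE²_BM = replicaSEsq` of the `a` batch means of length `b`)

* **`chain_batchMeans_sigmaHat_mse_le_of_nHit`** — `∃ K K', ∀ μ₀, ∀ a ≥ 2, ∀ b ≥ 1,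
  E_{μ₀}[(ab · SE²_BM − σ²_f)²] ≤ K/a + K'/b`;
* **`chain_batchMeans_sigmaHat_tendstoInMeasure_of_nHit`** — `a_n → ∞`, `b_n → ∞`:
  `TendstoInMeasure P_{μ₀} (fun n x => a_n b_n · SE²_BM(x)) atTop (fun _ => σ²_f)`;
* `greenKubo_nonneg_of_nHit`, `greenKubo_le_of_nHit` — `0 ≤ σ²_f ≤ (4C (ρ^m)⁻¹ (m+1)/e)²`
  (`ρ = 1 − e/(m+1)`), the variance bounds in the same generality.

NOT CLAIMED: rates in `m, ε` beyond the existence of `K, K'` (the proof's constants are explicit in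
`Scoring/BatchMeansConsistencyEnvelope.lean` with `A = (ρ^m)⁻¹`, `ρ = 1 − e/(m+1)`); overlapping
batches; unbounded observables; any `ε, m` of a concrete sampler.
-/

noncomputable section

namespace Summit.Ventures.LatticeQCDFlow.Scoring

open MeasureTheory ProbabilityTheory Filter Finset Preorder Literature.Probability.MarkovChains
open scoped ENNReal Topology

variable {Ω : Type*} [MeasurableSpace Ω]

section Power

variable {κ : Kernel Ω Ω} [IsMarkovKernel κ] {ν : Measure Ω} [IsProbabilityMeasure ν] {ε : ℝ≥0∞}
  {π : Measure Ω} [IsProbabilityMeasure π] {m : ℕ}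

/-- **MEAN-SQUARE CONSISTENCY OF THE BATCH-MEANS ESTIMATOR UNDER A DOEBLIN POWER, FROM ANY START.**
`π` invariant, `(nHit κ m)(x, ·) ≥ ε ν` (`0 < ε ≤ 1`, `0 < m`), `|f| ≤ C` measurable.  There are
constants `K, K'` (depending on `C, ε, m` only) such that for EVERY initial law `μ₀`, every number of
batches `a ≥ 2` and every batch length `b ≥ 1`: `E_{μ₀}[(ab · SE²_BM − σ²_f)²] ≤ K/a + K'/b`. -/
theorem chain_batchMeans_sigmaHat_mse_le_of_nHit (hπ : Kernel.Invariant κ π)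
    (hmin : ∀ x {B : Set Ω}, MeasurableSet B → ε * ν B ≤ Exactness.nHit κ m x B) (hε0 : 0 < ε)
    (hε1 : ε ≤ 1) (hm : 0 < m) {f : Ω → ℝ} (hf : Measurable f) {C : ℝ} (hC : ∀ x, |f x| ≤ C) :
    ∃ K K' : ℝ, ∀ (μ₀ : Measure Ω) [IsProbabilityMeasure μ₀] (a b : ℕ), 2 ≤ a → b ≠ 0 →
      ∫ x, (((b * a : ℕ) : ℝ)
          * replicaSEsq (fun j (x : ℕ → Ω) => (∑ i ∈ Finset.range b, f (x (b * j + i))) / b) a x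
          - ((∫ y, (f y - ∫ z, f z ∂π) ^ 2 ∂π)
            + 2 * ∑' k, ∫ y, (f y - ∫ z, f z ∂π)
              * (kop κ)^[k + 1] (fun y => f y - ∫ z, f z ∂π) y ∂π)) ^ 2
        ∂(Kernel.trajMeasure (X := fun _ : ℕ => Ω) μ₀
          (fun n : ℕ => κ.comap (fun h : (i : ↥(Finset.Iic n)) → Ω => h ⟨n, Finset.mem_Iic.2 le_rfl⟩)
            (measurable_pi_apply _)))
        ≤ K / a + K' / b := by
  obtain ⟨A, ρ, hA, hρ0, hρ1, henv⟩ := exists_geometricEnvelope_of_nHit hmin hε0 hε1 hm hπ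
  exact chain_batchMeans_sigmaHat_mse_le_of_envelope hπ henv hA hρ0 hρ1 hf hC

/-- **CONVERGENCE IN PROBABILITY OF THE BATCH-MEANS ESTIMATOR UNDER A DOEBLIN POWER.**  Same
hypotheses; for any `a_n → ∞`, `b_n → ∞` and EVERY initial law `μ₀`:
`TendstoInMeasure P_{μ₀} (fun n x => a_n b_n · SE²_BM(x; a_n, b_n)) atTop (fun _ => σ²_f)`. -/
theorem chain_batchMeans_sigmaHat_tendstoInMeasure_of_nHit (hπ : Kernel.Invariant κ π)
    (hmin : ∀ x {B : Set Ω}, MeasurableSet B → ε * ν B ≤ Exactness.nHit κ m x B) (hε0 : 0 < ε)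
    (hε1 : ε ≤ 1) (hm : 0 < m) {f : Ω → ℝ} (hf : Measurable f) {C : ℝ} (hC : ∀ x, |f x| ≤ C)
    (μ₀ : Measure Ω) [IsProbabilityMeasure μ₀] {a b : ℕ → ℕ} (ha : Tendsto a atTop atTop)
    (hb : Tendsto b atTop atTop) :
    TendstoInMeasure (Kernel.trajMeasure (X := fun _ : ℕ => Ω) μ₀
        (fun n : ℕ => κ.comap (fun h : (i : ↥(Finset.Iic n)) → Ω => h ⟨n, Finset.mem_Iic.2 le_rfl⟩)
          (measurable_pi_apply _)))
      (fun (n : ℕ) (x : ℕ → Ω) => ((b n * a n : ℕ) : ℝ)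
        * replicaSEsq (fun j (x : ℕ → Ω) => (∑ i ∈ Finset.range (b n), f (x (b n * j + i))) / (b n))
          (a n) x)
      atTop (fun _ => (∫ y, (f y - ∫ z, f z ∂π) ^ 2 ∂π)
        + 2 * ∑' k, ∫ y, (f y - ∫ z, f z ∂π) * (kop κ)^[k + 1] (fun y => f y - ∫ z, f z ∂π) y ∂π) := by
  obtain ⟨A, ρ, hA, hρ0, hρ1, henv⟩ := exists_geometricEnvelope_of_nHit hmin hε0 hε1 hm hπ
  exact chain_batchMeans_sigmaHat_tendstoInMeasure_of_envelope hπ henv hA hρ0 hρ1 hf hC μ₀ ha hb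

/-- **`0 ≤ σ²_f` under a Doeblin power** (`π` invariant, `0 < ε ≤ 1`, `0 < m`, `|f| ≤ C` measurable). -/
theorem greenKubo_nonneg_of_nHit (hπ : Kernel.Invariant κ π)
    (hmin : ∀ x {B : Set Ω}, MeasurableSet B → ε * ν B ≤ Exactness.nHit κ m x B) (hε0 : 0 < ε)
    (hε1 : ε ≤ 1) (hm : 0 < m) {f : Ω → ℝ} (hf : Measurable f) {C : ℝ} (hC : ∀ x, |f x| ≤ C) :
    0 ≤ (∫ y, (f y - ∫ z, f z ∂π) ^ 2 ∂π)
        + 2 * ∑' k, ∫ y, (f y - ∫ z, f z ∂π) * (kop κ)^[k + 1] (fun y => f y - ∫ z, f z ∂π) y ∂π := by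
  obtain ⟨A, ρ, -, hρ0, hρ1, henv⟩ := exists_geometricEnvelope_of_nHit hmin hε0 hε1 hm hπ
  exact greenKubo_nonneg_of_envelope hπ henv hρ0 hρ1 hf hC

/-- **An explicit ceiling on `σ²_f` under a Doeblin power**: with `ρ = 1 − e/(m+1)`,
`σ²_f ≤ (4 C (ρ^m)⁻¹ / (1 − ρ))²` (and `1/(1 − ρ) = (m+1)/e`). -/
theorem greenKubo_le_of_nHit (hπ : Kernel.Invariant κ π)
    (hmin : ∀ x {B : Set Ω}, MeasurableSet B → ε * ν B ≤ Exactness.nHit κ m x B) (hε0 : 0 < ε)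
    (hε1 : ε ≤ 1) (hm : 0 < m) {f : Ω → ℝ} (hf : Measurable f) {C : ℝ} (hC : ∀ x, |f x| ≤ C) :
    (∫ y, (f y - ∫ z, f z ∂π) ^ 2 ∂π)
        + 2 * ∑' k, ∫ y, (f y - ∫ z, f z ∂π) * (kop κ)^[k + 1] (fun y => f y - ∫ z, f z ∂π) y ∂π
      ≤ (4 * C * ((1 - ε.toReal / ((m : ℝ) + 1)) ^ m)⁻¹ / (1 - (1 - ε.toReal / ((m : ℝ) + 1)))) ^ 2 := by
  have hεtop : ε ≠ ∞ := ne_top_of_le_ne_top ENNReal.one_ne_top hε1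
  have he0 : 0 < ε.toReal := ENNReal.toReal_pos hε0.ne' hεtop
  have he1 : ε.toReal ≤ 1 := ENNReal.toReal_le_of_le_ofReal zero_le_one (by simpa using hε1)
  have hρ0 : 0 < 1 - ε.toReal / ((m : ℝ) + 1) := doeblinPower_rate_pos he1 hm
  exact greenKubo_le_of_envelope hπ (fun g hg Cg hCg t x =>
    geometricEnvelope_of_nHit hmin hε1 hm hπ hg hCg t x) hρ0.le (doeblinPower_rate_lt_one he0 m)
    hf hC

end Power

end Summit.Ventures.LatticeQCDFlow.Scoring

end
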